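import Literature.Probability.LatticeModels.PlaneRotatorFreeTwoPoint
import Literature.Probability.LatticeModels.PlaneRotatorComponentCone
import Literature.Probability.LatticeModels.MessagerMiracleSole
import HarnessLib

/-!
# The Messager–Miracle-Solé inequality for the plane rotator (classical XY model):
# reflection monotonicity of the two-point function, `G_K(0, x + eᵢ) ≤ G_K(0, x)` and
# `G_K(0, x + eᵢ − eⱼ) ≤ G_K(0, x)`

Topic `Literature/Probability/LatticeModels` (cell `pub/hubbard-tc`, D-0154 (1) block (D), literature seat
`hub-tc-therm-lit-2`, lead ruling R124; register `lit/THERMAL-LIT-LOCATORS-therm-lit-1.md` §I′ O1′). Everything here is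
PROVED; no definition, no named fact, no instance is introduced.

For the ferromagnetic plane rotator (`−H = ∑ J_{xy} cos(θ_x − θ_y)`, `J ≥ 0`) the two-point function
`⟨cos(θ_a − θ_b)⟩` can only DECREASE when `b` is replaced by its mirror image `ρb` across a reflection symmetry `ρ` of
the couplings leaving `a` and `b` on the same side — the plane-rotator case of the Messager–Miracle-Solé inequalities
(A. Messager, S. Miracle-Solé, C. Pfister, Comm. Math. Phys. **58** (1978) 19 [MessagerMiraclesolePfister1978], the
rotator companion of Messager–Miracle-Solé, J. Stat. Phys. **17** (1977) 245 [MessagerMiracleSoleJSP1977] and of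
G. C. Hegerfeldt, Comm. Math. Phys. **57** (1977) 259 [Hegerfeldt1977], Thms 3.1–3.2, whose Ising statements the tree
proves in `MessagerMiracleSole.lean`). On `ℤ²` the consequence printed by D. van Engelenburg, M. Lis, Comm. Math.
Phys. **399** (2023) 85 [VanEngelenburgLis2023], Lemma 21, reads: *«For any `n ∈ ℤ`, the two sequences
`⟨σ_0 σ̄_{(n,k)}⟩_{ℤ²,β}` and `⟨σ_0 σ̄_{(n+k,n−k)}⟩_{ℤ²,β}` are nonincreasing in `k` for `k ≥ 0`»*, deduced from their
Lemma 22: *«Let `G = (V,E)` be a subgraph of `ℤ²` symmetric under reflection across a line `L`. Let `a, b ∈ V` lie on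
the same side of `L`, and let `L(b) ∈ V` be the reflection of `b`. Then `⟨σ_aσ̄_b⟩_{G,β} ≥ ⟨σ_aσ̄_{L(b)}⟩_{G,β}`»* —
printed there with a proof only «when `L` passes through vertices» (diagonals, integer axis lines), the edge case being
«left to the interested reader». This file proves BOTH cases, in every dimension, by the classical analytic route
(reflected duplicate variables + a Ginibre/Griffiths positivity), in the tree's plane-rotator vocabulary
(`PlaneRotator.twoPoint J` on a finite vertex set, `volTwoPoint` / `infTwoPoint K ν` on `ℤ^ν`):

* §1 **Folding.** For an involution `ρ` of the sites with positive side `P` substitute `θ_x = φ_xψ_x` (`x ∈ P`),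
  `θ_{ρx} = φ_xψ̄_x`, `θ_f = φ_f` (fixed sites). In components (`spinRe`/`spinIm` of `PlaneRotatorComponentCone.lean`)
  every bond paired with its mirror image becomes an element of the tree's **component cone** `IsCompPos` on the
  doubled torus (`isCompPos_fold_pair/self/fixed/fixed_fixed`: `2cos∇φ cos∇ψ`, `4cos²ψ_x − 2`, `2cosψ_x cos∇φ`,
  `2cos∇φ`), so the folded Hamiltonian is a cone element plus a constant (`exists_isCompPos_hamiltonian_fold`, under the
  geometric condition «no bond joins `P` to `ρP` except the self-bonds `{x, ρx}`»), and the reflection-symmetrised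
  observable `cos(θ_b−θ_a) + cos(θ_{ρb}−θ_{ρa}) − cos(θ_{ρb}−θ_a) − cos(θ_b−θ_{ρa}) = 4cos(φ_b−φ_a) sin ψ_a sin ψ_b` is
  a cone element too (`isCompPos_fold_observable` — the sines are why the two-sided cone, not Ginibre's symmetric
  positive kernels, is needed). The fold is a continuous surjective homomorphism `U(1)^V × U(1)^V → U(1)^V`, hence
  Haar-measure preserving (`integral_comp_fold`, Mathlib `MonoidHom.measurePreserving`).
* §2 **The inequality on a finite vertex set** (`twoPoint_reflect_le`): for `ρ`-invariant `J ≥ 0` with the geometric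
  condition and `a, b ∈ P`, `twoPoint J a (ρ b) ≤ twoPoint J a b` — by `ρ`-invariance
  `2(⟨σ_aσ_b⟩ − ⟨σ_aσ_{ρb}⟩)` is the expectation of the symmetrised observable, whose folded integral against
  `e^{D + c}` is non-negative (`IsCompPos.integral_mul_exp_nonneg`).
* §3 **`ℤ^ν`** (nearest-neighbour couplings `nnXYCoupling K`, `K ≥ 0`): the finite-volume inequality on `θ`-stable
  volumes (`volTwoPoint_reflect_le`, geometry exactly as in the tree's Ising `plusCorr_pair_reflect_le`), the
  infinite-volume free state along the `θ`-symmetrised boxes `Λ(L) ∪ θΛ(L)` (`tendsto_volTwoPoint_symBox`,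
  `infTwoPoint_reflect_le`), the half-integer axis mirrors `axisRefl i k`, `k` odd (`infTwoPoint_axisRefl_le` — the
  «edge» case) and the diagonal mirrors `diagRefl i j c` (`infTwoPoint_diagRefl_le` — the «vertex» case), and the
  user-facing forms at base point `0`:
  **`infTwoPoint_zero_add_single_le`** (`xᵢ ≥ 0 ⇒ G_K(0, x + eᵢ) ≤ G_K(0, x)`),
  **`infTwoPoint_zero_add_single_sub_single_le`** (`xⱼ ≤ xᵢ ⇒ G_K(0, x + eᵢ − eⱼ) ≤ G_K(0, x)`),
  `infTwoPoint_zero_add_nsmul_single_antitone`.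

Consumers (cell `pub/hubbard-tc`): the ℓ∞-sphere/axis comparisons of the XY two-point function itself for the
certificate engines (Lieb box / Onsager-length / Fisher windows), the `massGap = invCorrLength` rider announced as NOT
CLAIMED in `PlaneRotatorCorrelationLength.lean`, and the explicit power-law lower bound «`χ(K) = ∞ ⇒ G_K(0,v) ≥
1/(8‖v‖₁)`» of van Engelenburg–Lis §6 (companion file). WHAT THIS IS NOT: a statement about any quantum / Hubbard
model; general `O(N)`; general (non-pair) interactions; no number of record.

## Faithfulness notes

* The finite-vertex-set theorem allows bonds INTO fixed sites and the self-bonds `{x, ρx}` across the mirror, and any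
  `ρ`-invariant ferromagnetic pair couplings (not only nearest neighbours) — the hypothesis set of Hegerfeldt 1977 §2 /
  Messager–Miracle-Solé 1977 for the Ising case; only the pair observable `cos(θ_a − θ_b)` is treated (the printed
  rotator theorem covers products over sets `A, B`).
* On `ℤ^ν` only free boundary conditions along boxes (the tree's `infTwoPoint`, which by Griffiths–Ginibre is the
  free-state thermodynamic limit) are treated.
* The original rotator paper [MessagerMiraclesolePfister1978] is not held (acquisition request acq-06228); its
  statement is cited through [VanEngelenburgLis2023, Lemmas 21–22] (held, quoted above) and no theorem number of the
  1978 paper is asserted.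

## References

* A. Messager, S. Miracle-Solé, C. Pfister, *Correlation inequalities and uniqueness of the equilibrium state for the
  plane rotator ferromagnetic model*, Comm. Math. Phys. 58 (1978) 19–29, doi:10.1007/bf01624786.
  [MessagerMiraclesolePfister1978]
* D. van Engelenburg, M. Lis, *An elementary proof of phase transition in the planar XY model*, Comm. Math. Phys. 399
  (2023) 85–104, arXiv:2110.09465, Lemma 21, Lemma 22 (Appendix, p. 16–17 of the arXiv version). [VanEngelenburgLis2023]
* A. Messager, S. Miracle-Solé, J. Stat. Phys. 17 (1977) 245–262. [MessagerMiracleSoleJSP1977]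
* G. C. Hegerfeldt, Comm. Math. Phys. 57 (1977) 259–266, Thm 3.1 eq. (3.8), Thm 3.2 eq. (3.10). [Hegerfeldt1977]
* J. Ginibre, Comm. Math. Phys. 16 (1970) 310–328 (duplicate variables). [Ginibre1970]
* J. Bricmont, J.-R. Fontaine, L. J. Landau, Comm. Math. Phys. 56 (1977) 281, Appendix (the component cone).
  [BricmontFontaineLandau1977]

## Mathlib / tree anchors

Mathlib: `MonoidHom.measurePreserving`, `MeasureTheory.integral_map`, `Fintype.sum_equiv`, `Function.Injective.extend_apply`,
`tendsto_of_tendsto_of_tendsto_of_le_of_le`, `le_of_tendsto_of_tendsto`, `antitone_nat_of_succ_le`. Tree: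
`IsCompPos` (+ `isCompPos_fst/snd/const`, `.add/.mul/.const_mul/.sum`, `.integral_mul_exp_nonneg`), `IsCompMonomial.spinRe/spinIm`,
`reChar_diffChar_eq_components`, `reChar_diffChar_comm`, `cosDiff_eq_reChar`, `surjective_mul_self_torus`, `torusHaar`,
`ginibreWeight`, `twoPoint`, `twoPoint_extend_eq`, `extendCoupling`, `volTwoPoint(_of_mem/_mono)`, `infTwoPoint`,
`tendsto_volTwoPoint_box`, `volEquiv`, `symBox`, `box_subset_symBox`, `symBox_subset_box`, `mem_symBox_iff`, `axisRefl(_apply/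
_involutive/_mem_box)`, `zdGraph_adj_axisRefl`, `diagRefl(…)`, `zdGraph_adj_coord`, `exists_forall_subset_box`, `nnXYCoupling`,
`zdGraph_adj_iff_norm_holds`.
-/

noncomputable section

open MeasureTheory Finset Filter Topology
open scoped BigOperators ComplexConjugate

namespace Literature.Probability.LatticeModels

namespace PlaneRotator

/-! ## §1 Folding a reflection-symmetric plane rotator: the duplicate variables in components -/

section FoldAux

variable {V : Type*}

/-- `cos² + sin² = 1` for a rotator. [folklore] -/
private theorem spinRe_sq_add_spinIm_sq (v : V) (θ : V → Circle) : spinRe v θ ^ 2 + spinIm v θ ^ 2 = 1 := by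
  have h := Circle.normSq_coe (θ v)
  rw [Complex.normSq_apply] at h
  simp only [spinRe, spinIm]
  nlinarith [h]

variable [DecidableEq V] (ρ : Equiv.Perm V) (P : Finset V)
  (fold : (V → Circle) × (V → Circle) → (V → Circle))
  (hfold : ∀ (z : (V → Circle) × (V → Circle)) (v : V), fold z v =
    if v ∈ P then z.1 v * z.2 v else if ρ v ∈ P then z.1 (ρ v) * (z.2 (ρ v))⁻¹ else z.1 v)

include hfold

/-- On the positive side the folded spin is `θ_v = φ_v ψ_v`: its cosine. [cite: Ginibre1970, main theorem (duplication θ = φ + ψ, θ' = φ − ψ)] -/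
theorem spinRe_fold_of_mem {v : V} (hv : v ∈ P) (z : (V → Circle) × (V → Circle)) :
    spinRe v (fold z) = spinRe v z.1 * spinRe v z.2 - spinIm v z.1 * spinIm v z.2 := by
  simp only [spinRe, spinIm, hfold, if_pos hv, Circle.coe_mul, Complex.mul_re]

/-- On the positive side the folded spin is `θ_v = φ_v ψ_v`: its sine. [cite: Ginibre1970, main theorem (duplication θ = φ + ψ, θ' = φ − ψ)] -/
theorem spinIm_fold_of_mem {v : V} (hv : v ∈ P) (z : (V → Circle) × (V → Circle)) :
    spinIm v (fold z) = spinRe v z.1 * spinIm v z.2 + spinIm v z.1 * spinRe v z.2 := by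
  simp only [spinRe, spinIm, hfold, if_pos hv, Circle.coe_mul, Complex.mul_im]

/-- On the reflected side the folded spin is `θ_{ρv} = φ_v ψ̄_v`: its cosine. [cite: Ginibre1970, main theorem (duplication θ = φ + ψ, θ' = φ − ψ)] -/
theorem spinRe_fold_apply_of_mem (hρ : Function.Involutive ρ) (hP : ∀ v ∈ P, ρ v ∉ P) {v : V} (hv : v ∈ P)
    (z : (V → Circle) × (V → Circle)) :
    spinRe (ρ v) (fold z) = spinRe v z.1 * spinRe v z.2 + spinIm v z.1 * spinIm v z.2 := by
  have h1 : ρ v ∉ P := hP v hv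
  have h2 : ρ (ρ v) ∈ P := by rw [hρ v]; exact hv
  simp only [spinRe, spinIm]
  rw [hfold, if_neg h1, if_pos h2, hρ v, Circle.coe_mul, Circle.coe_inv_eq_conj, Complex.mul_re,
    Complex.conj_re, Complex.conj_im]
  ring

/-- On the reflected side the folded spin is `θ_{ρv} = φ_v ψ̄_v`: its sine. [cite: Ginibre1970, main theorem (duplication θ = φ + ψ, θ' = φ − ψ)] -/
theorem spinIm_fold_apply_of_mem (hρ : Function.Involutive ρ) (hP : ∀ v ∈ P, ρ v ∉ P) {v : V} (hv : v ∈ P)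
    (z : (V → Circle) × (V → Circle)) :
    spinIm (ρ v) (fold z) = spinIm v z.1 * spinRe v z.2 - spinRe v z.1 * spinIm v z.2 := by
  have h1 : ρ v ∉ P := hP v hv
  have h2 : ρ (ρ v) ∈ P := by rw [hρ v]; exact hv
  simp only [spinRe, spinIm]
  rw [hfold, if_neg h1, if_pos h2, hρ v, Circle.coe_mul, Circle.coe_inv_eq_conj, Complex.mul_im,
    Complex.conj_re, Complex.conj_im]
  ring

/-- Fixed sites keep their spin: cosine. [cite: Ginibre1970, main theorem (duplication θ = φ + ψ, θ' = φ − ψ)] -/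
theorem spinRe_fold_of_fixed {v : V} (hv : v ∉ P) (hv' : ρ v ∉ P) (z : (V → Circle) × (V → Circle)) :
    spinRe v (fold z) = spinRe v z.1 := by
  simp only [spinRe, hfold, if_neg hv, if_neg hv']

/-- Fixed sites keep their spin: sine. [cite: Ginibre1970, main theorem (duplication θ = φ + ψ, θ' = φ − ψ)] -/
theorem spinIm_fold_of_fixed {v : V} (hv : v ∉ P) (hv' : ρ v ∉ P) (z : (V → Circle) × (V → Circle)) :
    spinIm v (fold z) = spinIm v z.1 := by
  simp only [spinIm, hfold, if_neg hv, if_neg hv']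

variable [Fintype V]

/-- **Folded bond, both ends on the positive side**: `cos(θ_y − θ_x) + cos(θ_{ρy} − θ_{ρx}) =
2 cos(φ_y − φ_x) cos(ψ_y − ψ_x)`, an element of the component cone. (Reflected duplicate variables after Ginibre 1970; Ising prototype Hegerfeldt 1977, §2 Main Lemma.) [folklore] -/
private theorem isCompPos_fold_pair (hρ : Function.Involutive ρ) (hP : ∀ v ∈ P, ρ v ∉ P) {x y : V} (hx : x ∈ P)
    (hy : y ∈ P) :
    IsCompPos (fun z => reChar (diffChar x y) (fold z) + reChar (diffChar (ρ x) (ρ y)) (fold z)) := by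
  have h : IsCompPos (fun z : (V → Circle) × (V → Circle) =>
      2 * ((spinRe x z.1 * spinRe y z.1 + spinIm x z.1 * spinIm y z.1) *
        (spinRe x z.2 * spinRe y z.2 + spinIm x z.2 * spinIm y z.2))) :=
    (isCompPos_const zero_le_two).mul
      ((((isCompPos_fst (IsCompMonomial.spinRe x)).mul (isCompPos_fst (IsCompMonomial.spinRe y))).add
        ((isCompPos_fst (IsCompMonomial.spinIm x)).mul (isCompPos_fst (IsCompMonomial.spinIm y)))).mul
      (((isCompPos_snd (IsCompMonomial.spinRe x)).mul (isCompPos_snd (IsCompMonomial.spinRe y))).add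
        ((isCompPos_snd (IsCompMonomial.spinIm x)).mul (isCompPos_snd (IsCompMonomial.spinIm y)))))
  convert h using 2 with z
  rw [reChar_diffChar_eq_components, reChar_diffChar_eq_components, spinRe_fold_of_mem ρ P fold hfold hx,
    spinRe_fold_of_mem ρ P fold hfold hy, spinIm_fold_of_mem ρ P fold hfold hx, spinIm_fold_of_mem ρ P fold hfold hy,
    spinRe_fold_apply_of_mem ρ P fold hfold hρ hP hx, spinRe_fold_apply_of_mem ρ P fold hfold hρ hP hy,
    spinIm_fold_apply_of_mem ρ P fold hfold hρ hP hx, spinIm_fold_apply_of_mem ρ P fold hfold hρ hP hy]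
  ring

/-- **Folded self-bond across the mirror**: `cos(θ_{ρx} − θ_x) + cos(θ_x − θ_{ρx}) + 2 = 4 cos² ψ_x`, an element of
the component cone. (Reflected duplicate variables after Ginibre 1970; Ising prototype Hegerfeldt 1977, §2 Main Lemma.) [folklore] -/
private theorem isCompPos_fold_self (hρ : Function.Involutive ρ) (hP : ∀ v ∈ P, ρ v ∉ P) {x : V} (hx : x ∈ P) :
    IsCompPos (fun z => reChar (diffChar x (ρ x)) (fold z) + reChar (diffChar (ρ x) x) (fold z) + 2) := by
  have h : IsCompPos (fun z : (V → Circle) × (V → Circle) => 4 * (spinRe x z.2 * spinRe x z.2)) :=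
    (isCompPos_const (by norm_num)).mul
      ((isCompPos_snd (IsCompMonomial.spinRe x)).mul (isCompPos_snd (IsCompMonomial.spinRe x)))
  convert h using 2 with z
  rw [reChar_diffChar_eq_components, reChar_diffChar_eq_components, spinRe_fold_of_mem ρ P fold hfold hx,
    spinIm_fold_of_mem ρ P fold hfold hx, spinRe_fold_apply_of_mem ρ P fold hfold hρ hP hx,
    spinIm_fold_apply_of_mem ρ P fold hfold hρ hP hx]
  have h1 := spinRe_sq_add_spinIm_sq x z.1
  have h2 := spinRe_sq_add_spinIm_sq x z.2
  linear_combination (2 * (spinRe x z.2 ^ 2 - spinIm x z.2 ^ 2)) * h1 - 2 * h2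

/-- **Folded bond into a fixed site**: `cos(θ_f − θ_x) + cos(θ_f − θ_{ρx}) = 2 cos ψ_x cos(φ_f − φ_x)`, an element of the
component cone. (Reflected duplicate variables after Ginibre 1970; Ising prototype Hegerfeldt 1977, §2 Main Lemma.) [folklore] -/
private theorem isCompPos_fold_fixed (hρ : Function.Involutive ρ) (hP : ∀ v ∈ P, ρ v ∉ P) {x f : V} (hx : x ∈ P)
    (hf : f ∉ P) (hf' : ρ f ∉ P) :
    IsCompPos (fun z => reChar (diffChar x f) (fold z) + reChar (diffChar (ρ x) f) (fold z)) := by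
  have h : IsCompPos (fun z : (V → Circle) × (V → Circle) =>
      2 * (spinRe x z.2 * (spinRe x z.1 * spinRe f z.1 + spinIm x z.1 * spinIm f z.1))) :=
    (isCompPos_const zero_le_two).mul ((isCompPos_snd (IsCompMonomial.spinRe x)).mul
      (((isCompPos_fst (IsCompMonomial.spinRe x)).mul (isCompPos_fst (IsCompMonomial.spinRe f))).add
        ((isCompPos_fst (IsCompMonomial.spinIm x)).mul (isCompPos_fst (IsCompMonomial.spinIm f)))))
  convert h using 2 with z
  rw [reChar_diffChar_eq_components, reChar_diffChar_eq_components, spinRe_fold_of_mem ρ P fold hfold hx,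
    spinIm_fold_of_mem ρ P fold hfold hx, spinRe_fold_apply_of_mem ρ P fold hfold hρ hP hx,
    spinIm_fold_apply_of_mem ρ P fold hfold hρ hP hx, spinRe_fold_of_fixed ρ P fold hfold hf hf',
    spinIm_fold_of_fixed ρ P fold hfold hf hf']
  ring

/-- **Bond between fixed sites**: `2 cos(φ_g − φ_f)`, an element of the component cone. (Reflected duplicate variables after Ginibre 1970; Ising prototype Hegerfeldt 1977, §2 Main Lemma.) [folklore] -/
private theorem isCompPos_fold_fixed_fixed {f g : V} (hf : f ∉ P) (hf' : ρ f ∉ P) (hg : g ∉ P) (hg' : ρ g ∉ P) :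
    IsCompPos (fun z => reChar (diffChar f g) (fold z) + reChar (diffChar f g) (fold z)) := by
  have h : IsCompPos (fun z : (V → Circle) × (V → Circle) =>
      2 * (spinRe f z.1 * spinRe g z.1 + spinIm f z.1 * spinIm g z.1)) :=
    (isCompPos_const zero_le_two).mul
      (((isCompPos_fst (IsCompMonomial.spinRe f)).mul (isCompPos_fst (IsCompMonomial.spinRe g))).add
        ((isCompPos_fst (IsCompMonomial.spinIm f)).mul (isCompPos_fst (IsCompMonomial.spinIm g))))
  convert h using 2 with z
  rw [reChar_diffChar_eq_components, spinRe_fold_of_fixed ρ P fold hfold hf hf', spinIm_fold_of_fixed ρ P fold hfold hf hf',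
    spinRe_fold_of_fixed ρ P fold hfold hg hg', spinIm_fold_of_fixed ρ P fold hfold hg hg']
  ring

/-- **The folded reflection observable**: `cos(θ_b − θ_a) + cos(θ_{ρb} − θ_{ρa}) − cos(θ_{ρb} − θ_a) − cos(θ_b − θ_{ρa})
= 4 cos(φ_b − φ_a) sin ψ_a sin ψ_b`, an element of the component cone (here the sines appear: this is why the cone, not
Ginibre's symmetric positive kernels, is needed). (Reflected duplicate variables after Ginibre 1970; Ising prototype Hegerfeldt 1977, §2 Main Lemma.) [folklore] -/
private theorem isCompPos_fold_observable (hρ : Function.Involutive ρ) (hP : ∀ v ∈ P, ρ v ∉ P) {a b : V} (ha : a ∈ P)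
    (hb : b ∈ P) :
    IsCompPos (fun z => cosDiff a b (fold z) + cosDiff (ρ a) (ρ b) (fold z) - cosDiff a (ρ b) (fold z)
      - cosDiff (ρ a) b (fold z)) := by
  have h : IsCompPos (fun z : (V → Circle) × (V → Circle) =>
      4 * ((spinRe a z.1 * spinRe b z.1 + spinIm a z.1 * spinIm b z.1) * (spinIm a z.2 * spinIm b z.2))) :=
    (isCompPos_const (by norm_num)).mul
      ((((isCompPos_fst (IsCompMonomial.spinRe a)).mul (isCompPos_fst (IsCompMonomial.spinRe b))).add
        ((isCompPos_fst (IsCompMonomial.spinIm a)).mul (isCompPos_fst (IsCompMonomial.spinIm b)))).mul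
      ((isCompPos_snd (IsCompMonomial.spinIm a)).mul (isCompPos_snd (IsCompMonomial.spinIm b))))
  convert h using 2 with z
  rw [cosDiff_eq_reChar, cosDiff_eq_reChar, cosDiff_eq_reChar, cosDiff_eq_reChar,
    reChar_diffChar_eq_components, reChar_diffChar_eq_components, reChar_diffChar_eq_components,
    reChar_diffChar_eq_components, spinRe_fold_of_mem ρ P fold hfold ha,
    spinRe_fold_of_mem ρ P fold hfold hb, spinIm_fold_of_mem ρ P fold hfold ha, spinIm_fold_of_mem ρ P fold hfold hb,
    spinRe_fold_apply_of_mem ρ P fold hfold hρ hP ha, spinRe_fold_apply_of_mem ρ P fold hfold hρ hP hb,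
    spinIm_fold_apply_of_mem ρ P fold hfold hρ hP ha, spinIm_fold_apply_of_mem ρ P fold hfold hρ hP hb]
  ring

/-- **The folded Hamiltonian lies in the component cone up to a constant.** For `ρ`-invariant ferromagnetic pair
couplings with no bond across the mirror other than the self-bonds `{x, ρx}` and bonds into fixed sites,
`H(fold(φ, ψ)) = D(φ, ψ) + c` with `D` in the cone (pair the bond `(x, y)` with its mirror image `(ρx, ρy)`).
(Reflected duplicate variables after Ginibre 1970; Ising prototype Hegerfeldt 1977, §2 Main Lemma.) [folklore] -/
private theorem exists_isCompPos_hamiltonian_fold (hρ : Function.Involutive ρ) (hP : ∀ v ∈ P, ρ v ∉ P)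
    (hfix : ∀ v, v ∉ P → ρ v ∉ P → ρ v = v) {J : V × V → ℝ} (hJ : ∀ p, 0 ≤ J p)
    (hJρ : ∀ x y : V, J (ρ x, ρ y) = J (x, y)) (hcross : ∀ x ∈ P, ∀ y ∈ P, x ≠ y → J (x, ρ y) = 0) :
    ∃ D : (V → Circle) × (V → Circle) → ℝ, IsCompPos D ∧ ∃ c : ℝ, ∀ z,
      ginibreHamiltonian (pairChars V) J (fold z) = D z + c := by
  -- symmetrise the bond sum under `p ↦ ρp`
  have hsym : ∀ θ : V → Circle, ginibreHamiltonian (pairChars V) J θ =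
      (1 / 2) * ∑ p : V × V, J p * (reChar (diffChar p.1 p.2) θ + reChar (diffChar (ρ p.1) (ρ p.2)) θ) := by
    intro θ
    have hre : ∑ p : V × V, J p * reChar (diffChar (ρ p.1) (ρ p.2)) θ =
        ∑ p : V × V, J p * reChar (diffChar p.1 p.2) θ :=
      Fintype.sum_equiv (ρ.prodCongr ρ) _ _ fun p => by
        obtain ⟨x, y⟩ := p
        simp only [Equiv.prodCongr_apply, Prod.map_apply, hJρ x y]
    unfold ginibreHamiltonian
    simp only [pairChars_apply, mul_add, Finset.sum_add_distrib, hre]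
    ring
  -- the correction making the self-bonds cone elements
  let corr : V × V → ℝ := fun p =>
    if p.2 = ρ p.1 ∧ p.1 ∈ P then 2 else if p.1 = ρ p.2 ∧ p.2 ∈ P then 2 else 0
  have hcorr_self : ∀ x ∈ P, corr (x, ρ x) = 2 := fun x hx => by
    simp [corr, hx]
  have hcorr_self' : ∀ y ∈ P, corr (ρ y, y) = 2 := fun y hy => by
    simp [corr, hy, hρ y, hP y hy]
  have hcorr_zero : ∀ x y : V, y ≠ ρ x → x ≠ ρ y → corr (x, y) = 0 := fun x y h1 h2 => by
    simp [corr, h1, h2]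
  have hcorr_zero' : ∀ x y : V, x ∉ P → y ∉ P → corr (x, y) = 0 := fun x y h1 h2 => by
    simp [corr, h1, h2]
  have hpair : ∀ p : V × V, IsCompPos (fun z => J p *
      (reChar (diffChar p.1 p.2) (fold z) + reChar (diffChar (ρ p.1) (ρ p.2)) (fold z) + corr p)) := by
    rintro ⟨x, y⟩
    by_cases hJ0 : J (x, y) = 0
    · simp only [hJ0, zero_mul]
      exact isCompPos_const le_rfl
    refine IsCompPos.const_mul ?_ (hJ (x, y))
    dsimp only
    by_cases hx : x ∈ P
    · by_cases hy : y ∈ P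
      · -- both ends on the positive side
        have hne1 : y ≠ ρ x := fun h => hP x hx (h ▸ hy)
        have hne2 : x ≠ ρ y := fun h => hP y hy (h ▸ hx)
        simp only [hcorr_zero x y hne1 hne2, add_zero]
        exact isCompPos_fold_pair ρ P fold hfold hρ hP hx hy
      · by_cases hy' : ρ y ∈ P
        · -- `y` on the reflected side: the bond is the self-bond `y = ρ x`
          have hyx : y = ρ x := by
            by_contra hne
            apply hJ0
            have h := hcross x hx (ρ y) hy' (fun h => hne (by rw [h, hρ y]))
            rwa [hρ y] at h
          subst hyx
          simp only [hcorr_self x hx, hρ x]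
          exact isCompPos_fold_self ρ P fold hfold hρ hP hx
        · -- `y` fixed
          have hyy : ρ y = y := hfix y hy hy'
          have hne1 : y ≠ ρ x := fun h => hy' (by rw [h, hρ x]; exact hx)
          have hne2 : x ≠ ρ y := fun h => hy (by rw [hyy] at h; rw [← h]; exact hx)
          simp only [hcorr_zero x y hne1 hne2, add_zero, hyy]
          exact isCompPos_fold_fixed ρ P fold hfold hρ hP hx hy hy'
    · by_cases hx' : ρ x ∈ P
      · by_cases hy : y ∈ P
        · -- `x` reflected, `y` positive: the self-bond `x = ρ y`
          have hxy : x = ρ y := by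
            by_contra hne
            apply hJ0
            have h := hcross (ρ x) hx' y hy (fun h => hne (by rw [← h, hρ x]))
            rwa [hJρ x y] at h
          subst hxy
          simp only [hcorr_self' y hy, hρ y]
          have h := isCompPos_fold_self ρ P fold hfold hρ hP hy
          convert h using 2 with z
          ring
        · by_cases hy' : ρ y ∈ P
          · -- both reflected: the mirror image of a positive-side bond
            simp only [hcorr_zero' x y hx hy, add_zero]
            have h := isCompPos_fold_pair ρ P fold hfold hρ hP hx' hy'
            simp only [hρ x, hρ y] at h
            convert h using 2 with z
            ring
          · -- `x` reflected, `y` fixed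
            have hyy : ρ y = y := hfix y hy hy'
            simp only [hcorr_zero' x y hx hy, add_zero, hyy]
            have h := isCompPos_fold_fixed ρ P fold hfold hρ hP hx' hy hy'
            simp only [hρ x] at h
            convert h using 2 with z
            ring
      · -- `x` fixed
        have hxx : ρ x = x := hfix x hx hx'
        by_cases hy : y ∈ P
        · have hne1 : y ≠ ρ x := fun h => hx (by rw [h, hxx] at hy; exact hy)
          have hne2 : x ≠ ρ y := fun h => hx' (by rw [h, hρ y]; exact hy)
          simp only [hcorr_zero x y hne1 hne2, add_zero, hxx]
          have h := isCompPos_fold_fixed ρ P fold hfold hρ hP hy hx hx'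
          convert h using 2 with z
          rw [reChar_diffChar_comm x y, reChar_diffChar_comm x (ρ y)]
        · by_cases hy' : ρ y ∈ P
          · simp only [hcorr_zero' x y hx hy, add_zero, hxx]
            have h := isCompPos_fold_fixed ρ P fold hfold hρ hP hy' hx hx'
            simp only [hρ y] at h
            convert h using 2 with z
            rw [reChar_diffChar_comm x y, reChar_diffChar_comm x (ρ y), add_comm]
          · have hyy : ρ y = y := hfix y hy hy'
            simp only [hcorr_zero' x y hx hy, add_zero, hxx, hyy]
            exact isCompPos_fold_fixed_fixed ρ P fold hfold hx hx' hy hy'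
  refine ⟨fun z => (1 / 2) * ∑ p : V × V, J p *
      (reChar (diffChar p.1 p.2) (fold z) + reChar (diffChar (ρ p.1) (ρ p.2)) (fold z) + corr p),
    (IsCompPos.sum fun p _ => hpair p).const_mul (by norm_num), -((1 / 2) * ∑ p : V × V, J p * corr p),
    fun z => ?_⟩
  rw [hsym]
  simp only [mul_add, Finset.sum_add_distrib]
  ring

/-- **The fold is a Haar-measure-preserving change of variables**: for the involution `ρ` with positive side `P`,
`(φ, ψ) ↦ θ` with `θ_v = φ_v ψ_v` on `P`, `θ_{ρv} = φ_v ψ̄_v` on `ρP`, `θ_f = φ_f` at fixed sites is a continuous surjective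
homomorphism `U(1)^V × U(1)^V → U(1)^V`, so `∫ F dθ = ∫∫ F(fold(φ, ψ)) dφ dψ`. [cite: Ginibre1970, main theorem (dθ dθ' = dφ dψ)] -/
theorem integral_comp_fold [MeasurableSpace Circle] [BorelSpace Circle] (hρ : Function.Involutive ρ)
    {F : (V → Circle) → ℝ} (hF : Continuous F) :
    ∫ z, F (fold z) ∂((torusHaar V).prod (torusHaar V)) = ∫ θ, F θ ∂(torusHaar V) := by
  -- the fold as a group homomorphism
  let Φ : (V → Circle) × (V → Circle) →* (V → Circle) :=
    { toFun := fold
      map_one' := by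
        funext v
        rw [hfold]
        simp
      map_mul' := fun z w => by
        funext v
        simp only [hfold, Pi.mul_apply, Prod.fst_mul, Prod.snd_mul]
        split_ifs
        · exact mul_mul_mul_comm _ _ _ _
        · rw [mul_inv, mul_mul_mul_comm]
        · rfl }
  have hΦ : ∀ z, Φ z = fold z := fun z => rfl
  have hcont : Continuous Φ := by
    refine continuous_pi fun v => ?_
    simp only [hΦ, hfold]
    split_ifs <;> fun_prop
  have hsurj : Function.Surjective Φ := by
    intro θ
    obtain ⟨s, hs⟩ := surjective_mul_self_torus (fun v => θ v * (θ (ρ v))⁻¹)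
    have hs' : ∀ v, s v * s v = θ v * (θ (ρ v))⁻¹ := fun v => congr_fun hs v
    refine ⟨(fun v => if v ∈ P then θ v * (s v)⁻¹ else θ v, fun v => if v ∈ P then s v else 1), ?_⟩
    funext v
    rw [hΦ, hfold]
    by_cases hv : v ∈ P
    · simp only [if_pos hv, inv_mul_cancel_right]
    · rw [if_neg hv]
      by_cases hv' : ρ v ∈ P
      · simp only [if_pos hv']
        calc θ (ρ v) * (s (ρ v))⁻¹ * (s (ρ v))⁻¹ = θ (ρ v) * (s (ρ v) * s (ρ v))⁻¹ := by
              rw [mul_inv, mul_assoc]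
          _ = θ v := by rw [hs' (ρ v), hρ v, mul_inv, inv_inv, ← mul_assoc, mul_inv_cancel, one_mul]
      · simp only [if_neg hv', if_neg hv]
  have hmp : MeasurePreserving Φ ((torusHaar V).prod (torusHaar V)) (torusHaar V) :=
    MonoidHom.measurePreserving hcont hsurj (by simp)
  calc ∫ z, F (fold z) ∂((torusHaar V).prod (torusHaar V))
      = ∫ θ, F θ ∂(((torusHaar V).prod (torusHaar V)).map Φ) :=
        (integral_map hmp.measurable.aemeasurable hF.aestronglyMeasurable).symm
    _ = ∫ θ, F θ ∂(torusHaar V) := by rw [hmp.map_eq]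

end FoldAux

/-! ## §2 The Messager–Miracle-Solé–Pfister inequality on a finite vertex set -/

section Abstract

variable {V : Type*} [Fintype V] [MeasurableSpace Circle] [BorelSpace Circle]

/-- Relabelling the sites by a symmetry of the couplings does not change the two-point function. [folklore] -/
private theorem twoPoint_perm_eq (ρ : Equiv.Perm V) {J : V × V → ℝ} (hJρ : ∀ x y : V, J (ρ x, ρ y) = J (x, y))
    (x y : V) : twoPoint J (ρ x) (ρ y) = twoPoint J x y := by
  have hext : extendCoupling ρ J = J := by
    funext p
    obtain ⟨x, y⟩ := p
    have hq : (x, y) = Prod.map ρ ρ (ρ.symm x, ρ.symm y) := by simp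
    rw [hq, extendCoupling, (ρ.injective.prodMap ρ.injective).extend_apply, Prod.map_apply, hJρ]
  have h := twoPoint_extend_eq ρ.injective J x y
  rwa [hext] at h

variable [DecidableEq V]

/-- **The Messager–Miracle-Solé–Pfister reflection inequality for the plane rotator (finite vertex set).** Let `ρ` be
an involution of the sites with a «positive side» `P` (`P ∩ ρP = ∅`, every site off `P ∪ ρP` fixed by `ρ`), and let
`J ≥ 0` be `ρ`-invariant pair couplings with NO bond joining `P` to `ρP` except the self-bonds `{x, ρx}` (bonds into
fixed sites are allowed). Then for `a, b ∈ P`: `⟨cos(θ_a − θ_{ρb})⟩_J ≤ ⟨cos(θ_a − θ_b)⟩_J` — the correlation with the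
mirror image is the smaller one. Proof: by `ρ`-invariance
`2(⟨σ_aσ_b⟩ − ⟨σ_aσ_{ρb}⟩) = ⟨Re (σ̄_a − σ̄_{ρa})(σ_b − σ_{ρb})⟩`; in the reflected duplicate variables
`θ_x = φ_xψ_x`, `θ_{ρx} = φ_xψ̄_x` this is `4⟨cos(φ_b − φ_a) sin ψ_a sin ψ_b⟩` for a weight `e^{D + c}` with `D` in the
component cone, hence `≥ 0` (Messager–Miracle-Solé–Pfister 1978 for rotators; the Ising prototype is
Messager–Miracle-Solé 1977 / Hegerfeldt 1977, tree `isingCorr_plus_pair_reflect_le`).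
[cite: VanEngelenburgLis2023, Lemma 22 (reflection across a line; the XY Messager–Miracle-Solé inequality)] [cite: Hegerfeldt1977, Thm 3.1 eq. (3.8) and Thm 3.2 eq. (3.10) (Ising prototype)] -/
theorem twoPoint_reflect_le (ρ : Equiv.Perm V) (hρ : Function.Involutive ρ) (P : Finset V)
    (hP : ∀ v ∈ P, ρ v ∉ P) (hfix : ∀ v, v ∉ P → ρ v ∉ P → ρ v = v) {J : V × V → ℝ} (hJ : ∀ p, 0 ≤ J p)
    (hJρ : ∀ x y : V, J (ρ x, ρ y) = J (x, y)) (hcross : ∀ x ∈ P, ∀ y ∈ P, x ≠ y → J (x, ρ y) = 0)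
    {a b : V} (ha : a ∈ P) (hb : b ∈ P) :
    twoPoint J a (ρ b) ≤ twoPoint J a b := by
  let fold : (V → Circle) × (V → Circle) → (V → Circle) := fun z v =>
    if v ∈ P then z.1 v * z.2 v else if ρ v ∈ P then z.1 (ρ v) * (z.2 (ρ v))⁻¹ else z.1 v
  have hfold : ∀ (z : (V → Circle) × (V → Circle)) (v : V), fold z v =
      if v ∈ P then z.1 v * z.2 v else if ρ v ∈ P then z.1 (ρ v) * (z.2 (ρ v))⁻¹ else z.1 v := fun z v => rfl
  -- the reflection-symmetrised observable
  have hgc : Continuous fun θ : V → Circle =>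
      cosDiff a b θ + cosDiff (ρ a) (ρ b) θ - cosDiff a (ρ b) θ - cosDiff (ρ a) b θ := by
    fun_prop
  have hwc : Continuous (ginibreWeight (pairChars V) J) := continuous_ginibreWeight _ _
  -- positivity of the folded integral
  have key : 0 ≤ ∫ θ, (cosDiff a b θ + cosDiff (ρ a) (ρ b) θ - cosDiff a (ρ b) θ - cosDiff (ρ a) b θ) *
      ginibreWeight (pairChars V) J θ ∂(torusHaar V) := by
    rw [show (∫ θ, (cosDiff a b θ + cosDiff (ρ a) (ρ b) θ - cosDiff a (ρ b) θ - cosDiff (ρ a) b θ) *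
        ginibreWeight (pairChars V) J θ ∂(torusHaar V)) = ∫ z : (V → Circle) × (V → Circle),
        (cosDiff a b (fold z) + cosDiff (ρ a) (ρ b) (fold z) - cosDiff a (ρ b) (fold z) - cosDiff (ρ a) b (fold z)) *
          ginibreWeight (pairChars V) J (fold z) ∂((torusHaar V).prod (torusHaar V)) from
      (integral_comp_fold ρ P fold hfold hρ (hgc.mul hwc)).symm]
    obtain ⟨D, hD, c, hc⟩ := exists_isCompPos_hamiltonian_fold ρ P fold hfold hρ hP hfix hJ hJρ hcross
    have hG := isCompPos_fold_observable ρ P fold hfold hρ hP ha hb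
    have hint : (fun z : (V → Circle) × (V → Circle) =>
        (cosDiff a b (fold z) + cosDiff (ρ a) (ρ b) (fold z) - cosDiff a (ρ b) (fold z) - cosDiff (ρ a) b (fold z)) *
          ginibreWeight (pairChars V) J (fold z)) = fun z =>
        Real.exp c * ((cosDiff a b (fold z) + cosDiff (ρ a) (ρ b) (fold z) - cosDiff a (ρ b) (fold z)
          - cosDiff (ρ a) b (fold z)) * Real.exp (D z)) := by
      funext z
      rw [ginibreWeight, hc z, Real.exp_add]
      ring
    rw [hint, integral_const_mul]
    exact mul_nonneg (Real.exp_pos c).le (hG.integral_mul_exp_nonneg hD)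
  -- back to two-point functions
  have hZ : 0 < ∫ θ, ginibreWeight (pairChars V) J θ ∂(torusHaar V) :=
    integral_exp_pos (integrable_torusHaar_of_continuous hwc)
  have hI : ∀ x y : V, twoPoint J x y =
      (∫ θ, cosDiff x y θ * ginibreWeight (pairChars V) J θ ∂(torusHaar V)) /
        ∫ θ, ginibreWeight (pairChars V) J θ ∂(torusHaar V) := fun x y => rfl
  have hi : ∀ x y : V, Integrable (fun θ => cosDiff x y θ * ginibreWeight (pairChars V) J θ) (torusHaar V) :=
    fun x y => integrable_torusHaar_of_continuous ((continuous_cosDiff x y).mul hwc)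
  have hi2 : Integrable (fun θ => cosDiff a b θ * ginibreWeight (pairChars V) J θ +
      cosDiff (ρ a) (ρ b) θ * ginibreWeight (pairChars V) J θ) (torusHaar V) := (hi a b).add (hi _ _)
  have hi3 : Integrable (fun θ => cosDiff a b θ * ginibreWeight (pairChars V) J θ +
      cosDiff (ρ a) (ρ b) θ * ginibreWeight (pairChars V) J θ -
      cosDiff a (ρ b) θ * ginibreWeight (pairChars V) J θ) (torusHaar V) := hi2.sub (hi _ _)
  have hsplit : ∫ θ, (cosDiff a b θ + cosDiff (ρ a) (ρ b) θ - cosDiff a (ρ b) θ - cosDiff (ρ a) b θ) *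
      ginibreWeight (pairChars V) J θ ∂(torusHaar V) =
      (∫ θ, cosDiff a b θ * ginibreWeight (pairChars V) J θ ∂(torusHaar V)) +
      (∫ θ, cosDiff (ρ a) (ρ b) θ * ginibreWeight (pairChars V) J θ ∂(torusHaar V)) -
      (∫ θ, cosDiff a (ρ b) θ * ginibreWeight (pairChars V) J θ ∂(torusHaar V)) -
      (∫ θ, cosDiff (ρ a) b θ * ginibreWeight (pairChars V) J θ ∂(torusHaar V)) := by
    simp only [add_mul, sub_mul]
    rw [integral_sub hi3 (hi _ _), integral_sub hi2 (hi _ _), integral_add (hi a b) (hi _ _)]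
  have h1 : twoPoint J (ρ a) (ρ b) = twoPoint J a b := twoPoint_perm_eq ρ hJρ a b
  have h2 : twoPoint J (ρ a) b = twoPoint J a (ρ b) := by
    conv_lhs => rw [← hρ b]
    exact twoPoint_perm_eq ρ hJρ a (ρ b)
  have hsum : 0 ≤ twoPoint J a b + twoPoint J (ρ a) (ρ b) - twoPoint J a (ρ b) - twoPoint J (ρ a) b := by
    rw [hI, hI, hI, hI, ← add_div, ← sub_div, ← sub_div, ← hsplit]
    exact div_nonneg key hZ.le
  linarith

end Abstract

/-! ## §3 The nearest-neighbour plane rotator on `ℤ^ν`: the Messager–Miracle-Solé inequalities for `G_K` -/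

section Lattice

open Literature.Barriers.CriticalPhenomena Literature.Barriers.CriticalPhenomena.LongRangeIsing

variable [MeasurableSpace Circle] [BorelSpace Circle] {ν : ℕ}

omit [MeasurableSpace Circle] [BorelSpace Circle] in
/-- Nearest neighbours of `ℤ^ν`: `nnCoupling ν x y = 𝟙{x ∼ y}` for the graph `zdGraph ν`. [folklore] -/
private theorem nnCoupling_eq_ite_adj (x y : Site ν) :
    nnCoupling ν x y = if (zdGraph ν).Adj x y then 1 else 0 := by
  have hadj : (zdGraph ν).Adj x y ↔ l1Norm (x - y) = 1 := by
    rw [zdGraph_adj_iff_norm_holds x y]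
    have h : ((l1Norm (x - y) : ℕ) : ℤ) = ∑ i, |x i - y i| := by
      simp only [l1Norm, Nat.cast_sum, Int.natCast_natAbs, Pi.sub_apply]
    rw [← h]
    norm_cast
  unfold nnCoupling
  simp only [hadj]

/-- **Messager–Miracle-Solé in a reflection-symmetric finite volume of `ℤ^ν`.** For an involutive automorphism
`θ` of `ℤ^ν`, a positive side `P` with `θ(P) ∩ P = ∅`, all sites off `P ∪ θ(P)` fixed and no bond from `P` to `θ(P)`
other than the bonds `{x, θx}`, and a `θ`-stable finite volume `Λ`: for `a, b ∈ Λ` on the positive side and `K ≥ 0`,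
`⟨cos(θ_a − θ_{θb})⟩_{Λ,K} ≤ ⟨cos(θ_a − θ_b)⟩_{Λ,K}` (free boundary condition). [cite: VanEngelenburgLis2023, Lemma 22 (reflection across a line; the XY Messager–Miracle-Solé inequality)] [cite: Hegerfeldt1977, Thm 3.1 eq. (3.8) and Thm 3.2 eq. (3.10) (Ising prototype)] -/
theorem volTwoPoint_reflect_le (θ : Site ν ≃ Site ν) (hθ : Function.Involutive θ)
    (hadj : ∀ x y, (zdGraph ν).Adj (θ x) (θ y) ↔ (zdGraph ν).Adj x y)
    (Pside : Site ν → Prop) [DecidablePred Pside] (hPθ : ∀ x, Pside x → ¬Pside (θ x))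
    (hfix : ∀ x, ¬Pside x → ¬Pside (θ x) → θ x = x)
    (hedge : ∀ x y, (zdGraph ν).Adj x y → Pside x → ¬Pside y → θ y ≠ y → y = θ x)
    {K : ℝ} (hK : 0 ≤ K) {Λ : Finset (Site ν)} (hΛ : ∀ x, x ∈ Λ ↔ θ x ∈ Λ)
    {a b : Site ν} (ha : a ∈ Λ) (hb : b ∈ Λ) (hPa : Pside a) (hPb : Pside b) :
    volTwoPoint K ν Λ a (θ b) ≤ volTwoPoint K ν Λ a b := by
  classical
  have hθb : θ b ∈ Λ := (hΛ b).1 hb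
  rw [volTwoPoint_of_mem K ha hθb, volTwoPoint_of_mem K ha hb]
  -- the restricted involution and positive side on the vertex type `Λ`
  let ρ : Equiv.Perm Λ := volEquiv θ hΛ
  have hρv : ∀ z : Λ, ((ρ z : Λ) : Site ν) = θ z := fun z => rfl
  have hρ : Function.Involutive ρ := fun z => Subtype.ext (by rw [hρv, hρv, hθ])
  let P : Finset Λ := Finset.univ.filter fun z : Λ => Pside (z : Site ν)
  have hmemP : ∀ z : Λ, z ∈ P ↔ Pside (z : Site ν) := fun z => by simp [P]
  have hP : ∀ z ∈ P, ρ z ∉ P := fun z hz => by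
    rw [hmemP] at hz ⊢
    rw [hρv]
    exact hPθ _ hz
  have hfix' : ∀ z, z ∉ P → ρ z ∉ P → ρ z = z := fun z hz hz' => by
    rw [hmemP] at hz hz'
    rw [hρv] at hz'
    exact Subtype.ext (hfix _ hz hz')
  have hJ : ∀ p : Λ × Λ, 0 ≤ nnXYCoupling K ν Λ p := fun p =>
    mul_nonneg (div_nonneg hK zero_le_two) (nnCoupling_nonneg _ _)
  have hJρ : ∀ x y : Λ, nnXYCoupling K ν Λ (ρ x, ρ y) = nnXYCoupling K ν Λ (x, y) := fun x y => by
    unfold nnXYCoupling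
    rw [nnCoupling_eq_ite_adj, nnCoupling_eq_ite_adj, hρv, hρv]
    simp only [hadj]
  have hcross : ∀ x ∈ P, ∀ y ∈ P, x ≠ y → nnXYCoupling K ν Λ (x, ρ y) = 0 := by
    intro x hx y hy hxy
    rw [hmemP] at hx hy
    unfold nnXYCoupling
    rw [nnCoupling_eq_ite_adj, hρv, if_neg, mul_zero]
    intro hxy'
    have hne : θ (θ (y : Site ν)) ≠ θ y := fun h => by
      rw [hθ] at h
      exact hPθ _ hy (h ▸ hy)
    have h := hedge _ _ hxy' hx (hPθ _ hy) hne
    exact hxy (Subtype.ext (θ.injective h.symm))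
  have key := twoPoint_reflect_le ρ hρ P hP hfix' hJ hJρ hcross (a := ⟨a, ha⟩) (b := ⟨b, hb⟩)
    ((hmemP _).2 hPa) ((hmemP _).2 hPb)
  exact key

/-- The finite-volume two-point functions along the `θ`-symmetrised boxes `Λ(L) ∪ θΛ(L)` converge to the
infinite-volume free-state two-point function (sandwich between `Λ(L)` and `Λ(L+R)`, Griffiths–Ginibre monotonicity in
the volume). [cite: Ginibre1970, Prop. 3 with Example 4 (plane rotators)] -/
theorem tendsto_volTwoPoint_symBox {θ : Site ν ≃ Site ν} {R : ℕ}
    (hR : ∀ L, ∀ y ∈ box ν L, θ y ∈ box ν (L + R)) {K : ℝ} (hK : 0 ≤ K) (x y : Site ν) :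
    Tendsto (fun L => volTwoPoint K ν (symBox θ L) x y) atTop (𝓝 (infTwoPoint K ν x y)) := by
  have hg := tendsto_volTwoPoint_box (ν := ν) hK x y
  have hf : Tendsto (fun L : ℕ => volTwoPoint K ν (box ν (L + R)) x y) atTop (𝓝 (infTwoPoint K ν x y)) :=
    (tendsto_add_atTop_iff_nat R).2 hg
  exact tendsto_of_tendsto_of_tendsto_of_le_of_le hg hf
    (fun L => volTwoPoint_mono hK (box_subset_symBox θ L) x y)
    (fun L => volTwoPoint_mono hK (symBox_subset_box hR L) x y)

/-- **The Messager–Miracle-Solé inequality for the infinite-volume two-point function of the plane rotator**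
(same geometric hypotheses, `θ` moving boxes boundedly): `G_K(a, θb) ≤ G_K(a, b)` for `a, b` on the positive side,
`K ≥ 0` — via the `θ`-symmetric volumes `Λ(L) ∪ θΛ(L)`. [cite: VanEngelenburgLis2023, Lemma 22 (reflection across a line; the XY Messager–Miracle-Solé inequality)] [cite: Hegerfeldt1977, Thm 3.1 eq. (3.8) and Thm 3.2 eq. (3.10) (Ising prototype)] -/
theorem infTwoPoint_reflect_le (θ : Site ν ≃ Site ν) (hθ : Function.Involutive θ)
    (hadj : ∀ x y, (zdGraph ν).Adj (θ x) (θ y) ↔ (zdGraph ν).Adj x y)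
    (Pside : Site ν → Prop) [DecidablePred Pside] (hPθ : ∀ x, Pside x → ¬Pside (θ x))
    (hfix : ∀ x, ¬Pside x → ¬Pside (θ x) → θ x = x)
    (hedge : ∀ x y, (zdGraph ν).Adj x y → Pside x → ¬Pside y → θ y ≠ y → y = θ x)
    {R : ℕ} (hR : ∀ L, ∀ y ∈ box ν L, θ y ∈ box ν (L + R)) {K : ℝ} (hK : 0 ≤ K)
    {a b : Site ν} (hPa : Pside a) (hPb : Pside b) :
    infTwoPoint K ν a (θ b) ≤ infTwoPoint K ν a b := by
  refine le_of_tendsto_of_tendsto (tendsto_volTwoPoint_symBox hR hK a (θ b))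
    (tendsto_volTwoPoint_symBox hR hK a b) ?_
  obtain ⟨L₀, hL₀⟩ := exists_forall_subset_box ν ({a, b} : Finset (Site ν))
  filter_upwards [eventually_ge_atTop L₀] with L hL
  have hsub : ({a, b} : Finset (Site ν)) ⊆ symBox θ L := (hL₀ L hL).trans (box_subset_symBox θ L)
  have ha : a ∈ symBox θ L := hsub (Finset.mem_insert_self a {b})
  have hb : b ∈ symBox θ L := hsub (Finset.mem_insert_of_mem (Finset.mem_singleton_self b))
  exact volTwoPoint_reflect_le θ hθ hadj Pside hPθ hfix hedge hK (fun x => mem_symBox_iff hθ x) ha hb hPa hPb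

/-- **Messager–Miracle-Solé for the half-integer axis hyperplanes**: for `k` odd and `K ≥ 0`,
`G_K(a, θb) ≤ G_K(a, b)` for the reflection `θ` through `{yᵢ = k/2}` and `a, b` with `2aᵢ < k`, `2bᵢ < k` (the «edge»
mirror: the bonds `{x, θx}` cross it; Hegerfeldt 1977 Thm 3.1 is the Ising twin, tree
`plusCorr_pair_axisRefl_le`). [cite: VanEngelenburgLis2023, Lemma 22 (reflection across a line; the XY Messager–Miracle-Solé inequality)] [cite: Hegerfeldt1977, Thm 3.1 eq. (3.8) and Thm 3.2 eq. (3.10) (Ising prototype)] -/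
theorem infTwoPoint_axisRefl_le (i : Fin ν) {k : ℤ} (hk : Odd k) {K : ℝ} (hK : 0 ≤ K) {a b : Site ν}
    (ha : 2 * a i < k) (hb : 2 * b i < k) :
    infTwoPoint K ν a (axisRefl i k b) ≤ infTwoPoint K ν a b := by
  classical
  refine infTwoPoint_reflect_le (axisRefl i k) (axisRefl_involutive i k) (zdGraph_adj_axisRefl i k)
    (fun y : Site ν => 2 * y i < k) ?_ ?_ ?_ (R := k.natAbs) (axisRefl_mem_box i k) hK ha hb
  · intro y hy
    simp only [axisRefl_apply, if_true, not_lt]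
    omega
  · intro y hy hθy
    simp only [axisRefl_apply, if_true, not_lt] at hy hθy
    exfalso
    obtain ⟨m, rfl⟩ := hk
    omega
  · intro y z hyz hy hz _
    simp only [not_lt] at hz
    obtain ⟨l, hl, hrest⟩ := zdGraph_adj_coord hyz
    funext m
    rw [axisRefl_apply]
    by_cases hm : m = i
    · subst hm
      rw [if_pos rfl]
      by_cases hlm : l = m
      · subst hlm
        obtain ⟨n, rfl⟩ := hk
        omega
      · have := hrest m (Ne.symm hlm)
        omega
    · rw [if_neg hm]
      by_cases hlm : l = m
      · subst hlm
        have := hrest i (Ne.symm hm)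
        omega
      · exact hrest m (Ne.symm hlm)

/-- **Messager–Miracle-Solé for the diagonal hyperplanes**: for `i ≠ j`, `c ∈ ℤ` and `K ≥ 0`, `G_K(a, θb) ≤ G_K(a, b)`
for the reflection `θ` through `{yᵢ − yⱼ = c}` and `a, b` with `aᵢ − aⱼ < c`, `bᵢ − bⱼ < c` (a «vertex» mirror: sites
on the hyperplane are fixed, no bond crosses; Hegerfeldt 1977 Thm 3.2 / van Engelenburg–Lis 2023 Lemma 22 print this
case). [cite: VanEngelenburgLis2023, Lemma 22 (reflection across a line; the XY Messager–Miracle-Solé inequality)] [cite: Hegerfeldt1977, Thm 3.1 eq. (3.8) and Thm 3.2 eq. (3.10) (Ising prototype)] [cite: VanEngelenburgLis2023, Lemma 22] -/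
theorem infTwoPoint_diagRefl_le {i j : Fin ν} (hij : i ≠ j) (c : ℤ) {K : ℝ} (hK : 0 ≤ K) {a b : Site ν}
    (ha : a i - a j < c) (hb : b i - b j < c) :
    infTwoPoint K ν a (diagRefl i j c b) ≤ infTwoPoint K ν a b := by
  classical
  refine infTwoPoint_reflect_le (diagRefl i j c) (diagRefl_involutive hij c) (zdGraph_adj_diagRefl i j c)
    (fun y : Site ν => y i - y j < c) ?_ ?_ ?_ (R := c.natAbs) (diagRefl_mem_box hij c) hK ha hb
  · intro y hy
    simp only [diagRefl_apply hij, if_true, if_neg hij.symm, not_lt]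
    omega
  · intro y hy hθy
    simp only [diagRefl_apply hij, if_true, if_neg hij.symm, not_lt] at hy hθy
    have hyc : y i - y j = c := le_antisymm (by omega) hy
    funext l
    rw [diagRefl_apply hij]
    split_ifs with h1 h2
    · subst h1; omega
    · subst h2; omega
    · rfl
  · intro y z hyz hy hz hθz
    exfalso
    apply hθz
    simp only [not_lt] at hz
    obtain ⟨l, hl, hrest⟩ := zdGraph_adj_coord hyz
    have hzc : z i - z j = c := by
      have h1 : z i - z j ≤ y i - y j + 1 := by
        by_cases hli : l = i
        · subst hli
          have := hrest j hij.symm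
          omega
        · by_cases hlj : l = j
          · subst hlj
            have := hrest i hij
            omega
          · have := hrest i (Ne.symm hli)
            have := hrest j (Ne.symm hlj)
            omega
      omega
    funext m
    rw [diagRefl_apply hij]
    split_ifs with h1 h2
    · subst h1; omega
    · subst h2; omega
    · rfl

/-- **`G_K(0, x + eᵢ) ≤ G_K(0, x)` for `xᵢ ≥ 0`**: the two-point function of the plane rotator is non-increasing along
every lattice axis away from the origin (reflection through `{yᵢ = xᵢ + ½}`). On `ℤ²` this is the first sequence of
van Engelenburg–Lis' Lemma 21. [cite: VanEngelenburgLis2023, Lemma 22 (reflection across a line; the XY Messager–Miracle-Solé inequality)] [cite: Hegerfeldt1977, Thm 3.1 eq. (3.8) and Thm 3.2 eq. (3.10) (Ising prototype)] [cite: VanEngelenburgLis2023, Lemma 21] -/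
theorem infTwoPoint_zero_add_single_le {K : ℝ} (hK : 0 ≤ K) (i : Fin ν) {x : Site ν} (hx : 0 ≤ x i) :
    infTwoPoint K ν 0 (x + Pi.single i 1) ≤ infTwoPoint K ν 0 x := by
  have h := infTwoPoint_axisRefl_le i (k := 2 * x i + 1) ⟨x i, rfl⟩ hK (a := 0) (b := x)
    (by simp only [Pi.zero_apply, mul_zero]; omega) (by omega)
  convert h using 2
  funext j
  rw [axisRefl_apply, Pi.add_apply]
  by_cases hj : j = i
  · subst hj
    rw [if_pos rfl, Pi.single_eq_same]
    ring
  · rw [if_neg hj, Pi.single_eq_of_ne hj, add_zero]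

/-- **`G_K(0, x + eᵢ − eⱼ) ≤ G_K(0, x)` for `xⱼ ≤ xᵢ`** (`i ≠ j`): moving a unit of displacement from the smaller
coordinate to the larger one lowers the two-point function (reflection through the diagonal hyperplane
`{yᵢ − yⱼ = xᵢ − xⱼ + 1}`). On `ℤ²` this gives the second sequence of van Engelenburg–Lis' Lemma 21. [cite: VanEngelenburgLis2023, Lemma 22 (reflection across a line; the XY Messager–Miracle-Solé inequality)] [cite: Hegerfeldt1977, Thm 3.1 eq. (3.8) and Thm 3.2 eq. (3.10) (Ising prototype)] [cite: VanEngelenburgLis2023, Lemma 21] -/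
theorem infTwoPoint_zero_add_single_sub_single_le {K : ℝ} (hK : 0 ≤ K) {i j : Fin ν} (hij : i ≠ j) {x : Site ν}
    (hx : x j ≤ x i) :
    infTwoPoint K ν 0 (x + Pi.single i 1 - Pi.single j 1) ≤ infTwoPoint K ν 0 x := by
  have h := infTwoPoint_diagRefl_le hij (x i - x j + 1) hK (a := 0) (b := x)
    (by simp only [Pi.zero_apply, sub_zero]; omega) (by omega)
  convert h using 2
  funext l
  rw [diagRefl_apply hij, Pi.sub_apply, Pi.add_apply]
  by_cases h1 : l = i
  · subst h1
    rw [if_pos rfl, Pi.single_eq_same, Pi.single_eq_of_ne hij]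
    ring
  · rw [if_neg h1]
    by_cases h2 : l = j
    · subst h2
      rw [if_pos rfl, Pi.single_eq_same, Pi.single_eq_of_ne (Ne.symm hij)]
      ring
    · rw [if_neg h2, Pi.single_eq_of_ne h1, Pi.single_eq_of_ne h2]
      ring

/-- **Monotonicity along an axis**: for `xᵢ ≥ 0` the sequence `m ↦ G_K(0, x + m eᵢ)` is non-increasing.
[cite: VanEngelenburgLis2023, Lemma 22 (reflection across a line; the XY Messager–Miracle-Solé inequality)] [cite: Hegerfeldt1977, Thm 3.1 eq. (3.8) and Thm 3.2 eq. (3.10) (Ising prototype)] -/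
theorem infTwoPoint_zero_add_nsmul_single_antitone {K : ℝ} (hK : 0 ≤ K) (i : Fin ν) {x : Site ν} (hx : 0 ≤ x i) :
    Antitone fun m : ℕ => infTwoPoint K ν 0 (x + (m : ℤ) • Pi.single i 1) := by
  refine antitone_nat_of_succ_le fun m => ?_
  have hm : 0 ≤ (x + (m : ℤ) • Pi.single i (1 : ℤ) : Site ν) i := by
    simp only [Pi.add_apply, Pi.smul_apply, Pi.single_eq_same, smul_eq_mul, mul_one]
    omega
  have h := infTwoPoint_zero_add_single_le hK i hm
  have e : (x + ((m + 1 : ℕ) : ℤ) • Pi.single i (1 : ℤ) : Site ν) =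
      x + (m : ℤ) • Pi.single i (1 : ℤ) + Pi.single i 1 := by
    rw [Nat.cast_succ, add_smul, one_smul, add_assoc]
  rw [e]
  exact h

end Lattice

end PlaneRotator

end Literature.Probability.LatticeModels

end
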